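import Summits.ResolutionOfSingularities.ResolutionOfSingularities.Theorems.FrobeniusLadderFRationalResolutionModelNormal
import Literature.AlgebraicGeometry.Resolution.NormalSurfaceSingularLocus
import Literature.AlgebraicGeometry.Resolution.QuasiProjectiveResolution
import Mathlib.AlgebraicGeometry.Morphisms.Proper
import HarnessLib

/-!
# The dimension `≤ 1` case of crux `FRationalResolution` (route `FrobeniusLadder`), unconditionally

Crux stmt-ResolutionOfSingularities-15317 `FrobeniusLadder.FRationalResolution` is, by
`fRationalResolution_iff_integral` (this directory), resolution of singularities for integral
separated finite-type `X/k` (char `p`) whose stalks satisfy the inline F-rational clause. This file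
settles its lowest-dimensional layer inside Lean, with no named fact: **an F-rational `k`-scheme of
finite type whose local rings have dimension `≤ 1` is regular**, hence is its own resolution.
The mechanism is Hochster–Huneke 1994 Thm. 4.2 (b) (F-rational ⇒ normal, tree:
`isIntegrallyClosed_stalk_of_fRational_clause`) followed by "normal ⇒ (R₁)" (a normal Noetherian
local domain of dimension `≤ 1` is a field or a DVR, tree:
`isRegularLocalRing_of_isIntegrallyClosed_of_ringKrullDim_le_one`). Consequences recorded here:

* `isRegularLocalRing_stalk_of_fRational_clause_of_ringKrullDim_le_one` — the singular locus of an
  F-rational scheme lives in codimension `≥ 2` (every stalk of dimension `≤ 1` is regular);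
* `isRegular_of_fRational_clause_of_dim_le_one`, `hasResolution_of_fRational_clause_of_dim_le_one`
  — F-rational curves (and points) are regular and resolved by the identity;
* `hasResolution_of_fRational_model_of_dim_le_one` — the crux instance: a separated finite-type
  `X/k` with an F-rational proper birational model of dimension `≤ 1` has a resolution.

So the open content of the crux starts in dimension `2` unconditionally, and in dimension `4`
modulo the in-tree named fact `Literature.AlgebraicGeometry.Resolution.CossartPiltant2019`
(`hasResolution_of_dim_le_three`, which does not use F-rationality at all).
-/

-- single-problem summit: the doubled namespace component `ResolutionOfSingularities` is forced
set_option linter.dupNamespace false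

noncomputable section

open CategoryTheory AlgebraicGeometry TopologicalSpace
open Literature.AlgebraicGeometry.Resolution

namespace Summit.ResolutionOfSingularities.ResolutionOfSingularities.Theorems.FRationalResolution

/-- **F-rational ⇒ regular in codimension `≤ 1`.** For a scheme `X` locally of finite type over a
field `k` of prime characteristic `p` whose stalks satisfy the F-rational clause of route
`FrobeniusLadder`, every stalk of Krull dimension `≤ 1` is a regular local ring (it is a normal
Noetherian local domain of dimension `≤ 1`: Hochster–Huneke 1994 Thm. 4.2 (b) + Matsumura
Thm. 11.2). -/
theorem isRegularLocalRing_stalk_of_fRational_clause_of_ringKrullDim_le_one (p : ℕ) (hp : p.Prime)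
    (k : Type) [Field k] [CharP k p] (X : Scheme.{0}) (f : X ⟶ Spec (.of k))
    [LocallyOfFiniteType f]
    (hFR : ∀ x : X, IsDomain (X.presheaf.stalk x) ∧ ∀ d : ℕ, ringKrullDim (X.presheaf.stalk x) = d →
      ∀ s : Fin d → X.presheaf.stalk x, (Ideal.span (Set.range s)).radical.IsMaximal →
      ∀ y c : X.presheaf.stalk x, c ≠ 0 →
      (∀ e : ℕ, c * y ^ p ^ e ∈ Ideal.span ((fun z : X.presheaf.stalk x => z ^ p ^ e) ''
        (Ideal.span (Set.range s) : Set (X.presheaf.stalk x)))) → y ∈ Ideal.span (Set.range s))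
    (x : X) (hx : ringKrullDim (X.presheaf.stalk x) ≤ 1) :
    IsRegularLocalRing (X.presheaf.stalk x) := by
  haveI : IsLocallyNoetherian X := LocallyOfFiniteType.isLocallyNoetherian f
  haveI : IsDomain (X.presheaf.stalk x) := (hFR x).1
  haveI : IsIntegrallyClosed (X.presheaf.stalk x) :=
    isIntegrallyClosed_stalk_of_fRational_clause p hp k X f hFR x
  exact isRegularLocalRing_of_isIntegrallyClosed_of_ringKrullDim_le_one (X.presheaf.stalk x) hx

/-- **F-rational schemes of dimension `≤ 1` are regular**: if `X` is locally of finite type over a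
field of characteristic `p`, its stalks satisfy the F-rational clause, and `dim X ≤ 1`, then every
local ring of `X` is regular (`dim 𝒪_{X,x} ≤ dim X ≤ 1`). -/
theorem isRegular_of_fRational_clause_of_dim_le_one (p : ℕ) (hp : p.Prime)
    (k : Type) [Field k] [CharP k p] (X : Scheme.{0}) (f : X ⟶ Spec (.of k))
    [LocallyOfFiniteType f]
    (hFR : ∀ x : X, IsDomain (X.presheaf.stalk x) ∧ ∀ d : ℕ, ringKrullDim (X.presheaf.stalk x) = d →
      ∀ s : Fin d → X.presheaf.stalk x, (Ideal.span (Set.range s)).radical.IsMaximal →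
      ∀ y c : X.presheaf.stalk x, c ≠ 0 →
      (∀ e : ℕ, c * y ^ p ^ e ∈ Ideal.span ((fun z : X.presheaf.stalk x => z ^ p ^ e) ''
        (Ideal.span (Set.range s) : Set (X.presheaf.stalk x)))) → y ∈ Ideal.span (Set.range s))
    (hdim : topologicalKrullDim X ≤ 1) : Scheme.IsRegular X := fun x =>
  isRegularLocalRing_stalk_of_fRational_clause_of_ringKrullDim_le_one p hp k X f hFR x
    ((ringKrullDim_stalk_le_topologicalKrullDim X x).trans hdim)

/-- **F-rational schemes of dimension `≤ 1` are resolved by the identity**: the integral core of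
crux `FRationalResolution` in dimension `≤ 1`, unconditionally (no separatedness or
quasi-compactness needed). -/
theorem hasResolution_of_fRational_clause_of_dim_le_one (p : ℕ) (hp : p.Prime)
    (k : Type) [Field k] [CharP k p] (X : Scheme.{0}) (f : X ⟶ Spec (.of k))
    [LocallyOfFiniteType f]
    (hFR : ∀ x : X, IsDomain (X.presheaf.stalk x) ∧ ∀ d : ℕ, ringKrullDim (X.presheaf.stalk x) = d →
      ∀ s : Fin d → X.presheaf.stalk x, (Ideal.span (Set.range s)).radical.IsMaximal →
      ∀ y c : X.presheaf.stalk x, c ≠ 0 →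
      (∀ e : ℕ, c * y ^ p ^ e ∈ Ideal.span ((fun z : X.presheaf.stalk x => z ^ p ^ e) ''
        (Ideal.span (Set.range s) : Set (X.presheaf.stalk x)))) → y ∈ Ideal.span (Set.range s))
    (hdim : topologicalKrullDim X ≤ 1) : Scheme.HasResolution X :=
  (isRegular_of_fRational_clause_of_dim_le_one p hp k X f hFR hdim).hasResolution

/-- **The crux in dimension `≤ 1`, unconditionally.** A separated `k`-scheme of finite type
(char `p`) admitting a proper birational model `X' → X` of dimension `≤ 1` whose stalks satisfy
the F-rational clause has a resolution of singularities: `X'` is regular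
(`isRegular_of_fRational_clause_of_dim_le_one`, `X'` being locally of finite type over `k`
through `π ≫ f`), so `π` itself is a resolution. -/
theorem hasResolution_of_fRational_model_of_dim_le_one (p : ℕ) (hp : p.Prime)
    (k : Type) [Field k] [CharP k p] (X : Scheme.{0}) (f : X ⟶ Spec (.of k))
    [LocallyOfFiniteType f]
    (hmodel : ∃ (X' : Scheme.{0}) (π : X' ⟶ X), IsProper π ∧ IsBirational π ∧
      topologicalKrullDim X' ≤ 1 ∧
      ∀ x : X', IsDomain (X'.presheaf.stalk x) ∧ ∀ d : ℕ, ringKrullDim (X'.presheaf.stalk x) = d →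
        ∀ s : Fin d → X'.presheaf.stalk x, (Ideal.span (Set.range s)).radical.IsMaximal →
        ∀ y c : X'.presheaf.stalk x, c ≠ 0 →
        (∀ e : ℕ, c * y ^ p ^ e ∈ Ideal.span ((fun z : X'.presheaf.stalk x => z ^ p ^ e) ''
          (Ideal.span (Set.range s) : Set (X'.presheaf.stalk x)))) → y ∈ Ideal.span (Set.range s)) :
    Scheme.HasResolution X := by
  obtain ⟨X', π, hπ, hbir, hdim, hFR⟩ := hmodel
  haveI := hπ
  haveI : LocallyOfFiniteType (π ≫ f) := inferInstance
  exact ⟨X', π, hπ, hbir, isRegular_of_fRational_clause_of_dim_le_one p hp k X' (π ≫ f) hFR hdim⟩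

end Summit.ResolutionOfSingularities.ResolutionOfSingularities.Theorems.FRationalResolution

end
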